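import Summits.ResolutionOfSingularities.ResolutionOfSingularities.Theorems.FrobeniusLadderFRationalResolutionBlowupFlatCriteria
import Literature.AlgebraicGeometry.Resolution.AlterationsLemma32
import Mathlib.AlgebraicGeometry.Morphisms.Smooth
import Mathlib.RingTheory.Localization.Ideal
import HarnessLib

/-!
# Crux `FrobeniusLadder.FRationalResolution` (stmt-ResolutionOfSingularities-15317), line `redirect`,
# stub `stub_diagonalizableQuotientResolution` — two glue lemmas for feeding `…DescendedPrimaryPiece` in the Galois route:
# regularity of a blow-up ASCENDS along a smooth base change, and a maximal ideal stays maximal on a basic open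

* **`isRegular_affineBlowup_map_of_smooth`** — `φ : B → C` with `Spec C → Spec B` smooth (e.g. the separable base change
  `C → (B ⊗_K K') ⊗_B C`): `Bl_I(Spec B)` regular ⇒ `Bl_{IC}(Spec C)` regular (blow-ups commute with flat base change, GW 13.91 (2);
  the projection `Bl_I ×_B C → Bl_I` is smooth; EGA IV 17.5.8 (iii));
* `isMaximal_map_away` — for a maximal `𝔪` and `h ∉ 𝔪`, `𝔪 B_h` is a maximal ideal of `B_h`.

Honest label: generic plumbing (no stub closed by name). No definitions, no named facts, no sorry.
[cite: GortzWedhorn2020, Prop. 13.91 (2)] [cite: Grothendieck1967, Prop. 17.5.8 (iii)]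
-/

noncomputable section

-- single-problem summit: the doubled namespace component is forced
set_option linter.dupNamespace false

open CategoryTheory CategoryTheory.Limits AlgebraicGeometry TopologicalSpace
open Literature.AlgebraicGeometry.Resolution
open Summit.ResolutionOfSingularities.ResolutionOfSingularities.Theorems.FRationalResolution

namespace Summit.ResolutionOfSingularities.ResolutionOfSingularities.Theorems.FRationalResolution.BlowupSmoothAscent

universe u

/-- **Regularity of a blow-up ascends along a smooth base change.** Let `φ : B → C` be such that `Spec C → Spec B` is smooth and
`B` Noetherian. If `Bl_I(Spec B)` is regular then `Bl_{IC}(Spec C)` is regular. [cite: GortzWedhorn2020, Prop. 13.91 (2)]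
[cite: Grothendieck1967, Prop. 17.5.8 (iii)] -/
theorem isRegular_affineBlowup_map_of_smooth {B C : Type u} [CommRing B] [CommRing C] [IsNoetherianRing B] (φ : B →+* C)
    [Smooth (Spec.map (CommRingCat.ofHom φ))] (I : Ideal B) (hreg : Scheme.IsRegular (affineBlowup I)) :
    Scheme.IsRegular (affineBlowup (I.map φ)) := by
  set j := Spec.map (CommRingCat.ofHom φ) with hj
  haveI : IsLocallyNoetherian (affineBlowup I) := LocallyOfFiniteType.isLocallyNoetherian (affineBlowup.π I)
  -- the base change of `Bl_I(Spec B)` along `j` is a blow-up of `Spec C` along `(IC)~`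
  have hbc : IsBlowup (pullback.snd (affineBlowup.π I) j) (affineBlowup.idealSheaf (I.map φ)) := by
    rw [← BlowupFlatCriteria.idealSheaf_comap_specMap]
    exact (affineBlowup.isBlowup I).pullback_snd_of_flat j
  -- it is smooth over `Bl_I(Spec B)`, hence regular
  have hPreg : Scheme.IsRegular (pullback (affineBlowup.π I) j) :=
    Scheme.IsRegular.of_smooth (pullback.fst (affineBlowup.π I) j) hreg
  obtain ⟨e, -, -⟩ := hbc.unique (affineBlowup.isBlowup (I.map φ))
  exact Scheme.IsRegular.of_iso e.hom hPreg

/-- **A maximal ideal stays maximal on a basic open around it**: for `𝔪` maximal and `h ∉ 𝔪`, `𝔪 B_h` is maximal.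
[cite: StacksProject, Tag 00CN] -/
theorem isMaximal_map_away {B : Type u} [CommRing B] (𝔪 : Ideal B) [h𝔪 : 𝔪.IsMaximal] {h : B} (hh : h ∉ 𝔪)
    (B' : Type u) [CommRing B'] [Algebra B B'] [IsLocalization.Away h B'] :
    (𝔪.map (algebraMap B B')).IsMaximal := by
  have hdisj : Disjoint ((Submonoid.powers h : Submonoid B) : Set B) (𝔪 : Set B) := by
    refine Set.disjoint_left.mpr ?_
    rintro x ⟨m, rfl⟩ hx
    exact hh (h𝔪.isPrime.mem_of_pow_mem m hx)
  haveI hprime : (𝔪.map (algebraMap B B')).IsPrime :=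
    IsLocalization.isPrime_of_isPrime_disjoint (Submonoid.powers h) B' 𝔪 h𝔪.isPrime hdisj
  have hcomap : (𝔪.map (algebraMap B B')).comap (algebraMap B B') = 𝔪 :=
    IsLocalization.under_map_of_isPrime_disjoint (Submonoid.powers h) B' h𝔪.isPrime hdisj
  refine ⟨⟨hprime.ne_top, fun M hM => ?_⟩⟩
  by_contra hMtop
  obtain ⟨N, hN, hMN⟩ := Ideal.exists_le_maximal M hMtop
  -- `N ∩ B ⊇ 𝔪`, hence `= 𝔪`, hence `N = 𝔪 B_h`, contradicting `𝔪 B_h < M ≤ N`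
  have hNc : N.comap (algebraMap B B') = 𝔪 := by
    refine (h𝔪.eq_of_le (Ideal.IsPrime.ne_top inferInstance) ?_).symm
    rw [← hcomap]
    exact Ideal.comap_mono (hM.le.trans hMN)
  have hNeq : N = 𝔪.map (algebraMap B B') := by
    rw [← hNc]
    exact (IsLocalization.map_under (Submonoid.powers h) B' N).symm
  exact (lt_irrefl _) ((hM.trans_le hMN).trans_eq hNeq)

end Summit.ResolutionOfSingularities.ResolutionOfSingularities.Theorems.FRationalResolution.BlowupSmoothAscent

end
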